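import Summits.QuantumFields.YangMills.Theorems.SwapVirialDeficitSectorLaplaceEndShellLetters
import Summits.QuantumFields.YangMills.Theorems.SwapVirialDeficitSectorLaplaceEndGaussCoreRate
import Summits.QuantumFields.YangMills.Theorems.SwapVirialDeficitSectorLaplaceEndGaussConstants
import Summits.QuantumFields.YangMills.Theorems.SwapVirialDeficitSectorLaplaceBulkMassFloor
import Summits.QuantumFields.YangMills.Theorems.SwapVirialDeficitBlowUpGnomonicFollowerLaplaceCeiling
import Summits.QuantumFields.YangMills.Theorems.SwapVirialDeficitSectorLaplaceBulkFibredBox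
import HarnessLib

/-!
# THE PLUG OF `stub_end_gaussCore` (memo-ε), PART 1: the polynomial constants and ★★ the rate `τ^{1/6}` of the main part
# (skeleton ➎ of cell ym-idea-1; free-hands support of ⟨stmt-QuantumFields-24197⟩ `SwapVirialDeficit.SwapGluedStiffness`; w3 g67 memo-ε steps 3 and 5,
# LEAD g99 memo11 §3/§4 (N3/N4 → assembler))

The matched comparison `hG♭` of ✓`stub_core_end_of_gaussCore` is reached from the N2 socket (✓`endGauss_slab_le_of_N2`) by the chain (α)+(γ)+(δ) of memo-ε
(Part 3, ✓`setIntegral_endGaussCore_le_of_socket`), which leaves the real number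
`K(c)·(a·(e·Kσ + √τ)·(C_F·(8/r)·Shell(r)) + T·(36 τ^{1/6} + π²√τ))`, `c = b/(6·55200L⁶)`, `a = CA·L^cA·(2π/((1−1/(2d))b))^{d/2}`.
This file does the polynomial bookkeeping of its MAIN part at the shell radius `r(L) := μ_F/(6|Fol L|·122689728·L⁴)` (so that the matching exponent of
✓`endGauss_shell_ge_D` is exactly `1/2`) and the smearing radius `ρ(L) := μ_F/(3|Fol L|·44712000·L⁴)` of ✓`D_ball_const`:
* §1 `leaderK_common_le` (`K(c) ≤ π⁴·2C₃·κ⁴·b^{−7/2}`, ✓`SigmaBall.leaderK_le`), `slabFactor_le` (`e·Kσ + √τ ≤ (900e/(4ρ²)+1)·τ^{1/6}`);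
* §2 `cell_sizes`, ★ `shellRadius_facts`, `smearRadius_facts`, ★ `shellConst_le` (`C_F·8/r ≤ (19·20400)⁴·3·(8·6·122689728·2304·36)·L⁵⁰`);
* §3 ★★ `mainPart_rate`: `2κ_L·(coneConst·π·MAIN) ≤ C·L^{114+cA}·τ^{1/6}·((2π/b)^α·(coneConst·π·Shell))` (✓`SigmaBall.folGauss_prefactor_le`,
  ✓`SigmaBall.b_pow_combine` with `(7+d)/2 = α` by ✓`finrank_gnoFibre_eq_card` ∕ ✓`finrank_gnoFol_real`).
Part 2 (`…EndGaussPlugTail`) absorbs the tail; Part 3 (`…EndGaussPlugChain`) is the per-point chain; Part 4 (`…EndGaussPlug`) is ★★★ `stub_end_gaussCore_of_N2`.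

HONEST LABEL: bookkeeping toward the plug of `stub_end_gaussCore`; until (P) (w3 g68 ✓`endGauss_params` / LEAD ✓`endGauss_N2_of_params`) and the plug land and the
skeleton is flipped, `stub_end_gaussCore` is OPEN; `stub_core_tip`, ⟨24197⟩ ∕ ⟨24194⟩ OPEN; item of record ⟨24085⟩ `SubOctaveBounded` aside ∕ untouched; the Yang–Mills
mass gap is NOT proved; no summit is proved by a line.  THEOREMS ONLY (0 `def`, 0 `sorry`), standard axioms, no instances beyond the series' local `ℍ` ones.
Seat ym-line-fcl-p3 g49 (cell ym-idea-1, free hands = ➎ assembler), `--supports stmt-QuantumFields-24197`.  References: [cite: Luscher1983, §2]; [folklore].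
-/

set_option autoImplicit false
set_option synthInstance.maxSize 1024

noncomputable section

open MeasureTheory Quaternion Set Module
open scoped Quaternion BigOperators ENNReal InnerProductSpace
open Literature.MathematicalPhysics.QuantumLattice
open Literature.MathematicalPhysics.QuantumFieldTheory hiding SU2
open Summit.QuantumFields.YangMills.Theorems.SwapTwistDeficit.ToronLog

namespace Summit.QuantumFields.YangMills.Theorems.SwapVirialDeficit.SectorLaplace

open Summit.QuantumFields.YangMills.Theorems.FemtoTransferGap
open Summit.QuantumFields.YangMills.Theorems.FemtoTransferGap.TT
open Summit.QuantumFields.YangMills.Theorems.VirialFluxGap.RingDeficit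
open Summit.QuantumFields.YangMills.Theorems.SwapVirialDeficit.SwapRing
open Summit.QuantumFields.YangMills.Theorems.SwapVirialDeficit.BlowUpRing
open Summit.QuantumFields.YangMills.Theorems.SwapVirialDeficit.Gnomonic (gnomonicWeight normSq3)

variable {L : ℕ} [NeZero L]

/-! ## §1 Scalar lemmas -/

omit [NeZero L] in
/-- The leader prefactor with the common rate `c = b/κ` (`κ ≥ 1`, `b > 0`): `π²/c·(π²/c)·(2C/((1+c)√(1+c))) ≤ (π⁴·2C·κ⁴)·(b⁻¹·b⁻¹·(b√b)⁻¹)`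
(✓`SigmaBall.leaderK_le`, then `κ√κ ≤ κ²`). [folklore] -/
theorem leaderK_common_le {b κ C : ℝ} (hb : 0 < b) (hκ : 1 ≤ κ) (hC : 0 ≤ C) :
    Real.pi ^ 2 / (b / κ) * (Real.pi ^ 2 / (b / κ)) * (2 * C / ((1 + b / κ) * Real.sqrt (1 + b / κ))) ≤
      (Real.pi ^ 4 * (2 * C) * κ ^ 4) * (b⁻¹ * b⁻¹ * (b * Real.sqrt b)⁻¹) := by
  have hκ0 : 0 < κ := by linarith
  have h := SigmaBall.leaderK_le (C := C) hb hκ0 hκ0 hκ0 hC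
  refine h.trans ?_
  have hs : Real.sqrt κ ≤ κ := by
    have h1 : Real.sqrt κ ≤ Real.sqrt (κ ^ 2) := Real.sqrt_le_sqrt (by nlinarith)
    rwa [Real.sqrt_sq hκ0.le] at h1
  have hβ : 0 ≤ b⁻¹ * b⁻¹ * (b * Real.sqrt b)⁻¹ := by positivity
  have hkey : Real.pi ^ 2 * κ * (Real.pi ^ 2 * κ) * (2 * C * (κ * Real.sqrt κ)) ≤ Real.pi ^ 4 * (2 * C) * κ ^ 4 := by
    have h2 : κ * Real.sqrt κ ≤ κ * κ := mul_le_mul_of_nonneg_left hs hκ0.le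
    have h3 : 0 ≤ Real.pi ^ 2 * κ * (Real.pi ^ 2 * κ) * (2 * C) := by positivity
    calc Real.pi ^ 2 * κ * (Real.pi ^ 2 * κ) * (2 * C * (κ * Real.sqrt κ))
        = Real.pi ^ 2 * κ * (Real.pi ^ 2 * κ) * (2 * C) * (κ * Real.sqrt κ) := by ring
      _ ≤ Real.pi ^ 2 * κ * (Real.pi ^ 2 * κ) * (2 * C) * (κ * κ) := mul_le_mul_of_nonneg_left h2 h3
      _ = Real.pi ^ 4 * (2 * C) * κ ^ 4 := by ring
  exact mul_le_mul_of_nonneg_right hkey hβ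

omit [NeZero L] in
/-- The slab smallness: with `s = √τ`, `0 < τ ≤ 1`, `0 < 2ρ ≤ 1`:
`e·(900 s^{1/3}(2ρ)^{1/3}(2ρ)^{1/3}((2ρ)(2ρ))⁻¹) + s ≤ (900·e·((2ρ)(2ρ))⁻¹ + 1)·τ^{1/6}`. [folklore] -/
theorem slabFactor_le {τ ρ : ℝ} (hτ : 0 < τ) (hτ1 : τ ≤ 1) (hρ : 0 < ρ) (hρ1 : 2 * ρ ≤ 1) :
    Real.exp 1 * (900 * (Real.sqrt τ) ^ (1 / 3 : ℝ) * (2 * ρ) ^ (1 / 3 : ℝ) * (2 * ρ) ^ (1 / 3 : ℝ) * ((2 * ρ) * (2 * ρ))⁻¹) + Real.sqrt τ ≤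
      (900 * Real.exp 1 * ((2 * ρ) * (2 * ρ))⁻¹ + 1) * τ ^ (1 / 6 : ℝ) := by
  have h2ρ : 0 ≤ 2 * ρ := by linarith
  have hs : (Real.sqrt τ) ^ (1 / 3 : ℝ) = τ ^ (1 / 6 : ℝ) := by
    rw [Real.sqrt_eq_rpow, ← Real.rpow_mul hτ.le]; norm_num
  have hq : (2 * ρ) ^ (1 / 3 : ℝ) ≤ 1 := Real.rpow_le_one h2ρ hρ1 (by norm_num)
  have hq0 : 0 ≤ (2 * ρ) ^ (1 / 3 : ℝ) := Real.rpow_nonneg h2ρ _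
  have hsτ : Real.sqrt τ ≤ τ ^ (1 / 6 : ℝ) := by
    rw [Real.sqrt_eq_rpow]
    exact Real.rpow_le_rpow_of_exponent_ge hτ hτ1 (by norm_num)
  have hτ6 : 0 ≤ τ ^ (1 / 6 : ℝ) := Real.rpow_nonneg hτ.le _
  have hR : 0 ≤ ((2 * ρ) * (2 * ρ))⁻¹ := by positivity
  rw [hs]
  have hqq : (2 * ρ) ^ (1 / 3 : ℝ) * (2 * ρ) ^ (1 / 3 : ℝ) ≤ 1 := by nlinarith
  have h1 : 900 * τ ^ (1 / 6 : ℝ) * (2 * ρ) ^ (1 / 3 : ℝ) * (2 * ρ) ^ (1 / 3 : ℝ) * ((2 * ρ) * (2 * ρ))⁻¹ ≤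
      900 * τ ^ (1 / 6 : ℝ) * ((2 * ρ) * (2 * ρ))⁻¹ := by
    have e : 900 * τ ^ (1 / 6 : ℝ) * (2 * ρ) ^ (1 / 3 : ℝ) * (2 * ρ) ^ (1 / 3 : ℝ) * ((2 * ρ) * (2 * ρ))⁻¹ =
        (900 * τ ^ (1 / 6 : ℝ) * ((2 * ρ) * (2 * ρ))⁻¹) * ((2 * ρ) ^ (1 / 3 : ℝ) * (2 * ρ) ^ (1 / 3 : ℝ)) := by ring
    rw [e]
    exact mul_le_of_le_one_right (by positivity) hqq
  have h2 := mul_le_mul_of_nonneg_left h1 (Real.exp_pos 1).le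
  nlinarith [h2, hsτ, mul_nonneg (Real.exp_pos 1).le (mul_nonneg (mul_nonneg (by norm_num : (0:ℝ) ≤ 900) hτ6) hR)]

/-! ## §2 The constants of the cell in powers of `L` -/

/-- `1 ≤ |Fol L| ≤ 6L⁴`, `0 < μ_F ≤ 1/2304`, `1 ≤ L` packaged. [folklore] -/
theorem cell_sizes : (1 : ℝ) ≤ L ∧ (1 : ℝ) ≤ (Fintype.card (Fol L) : ℝ) ∧ (Fintype.card (Fol L) : ℝ) ≤ 6 * (L : ℝ) ^ 4 ∧
    0 < (2304 * (L : ℝ) ^ 6 * (Fintype.card (Fol L) : ℝ))⁻¹ ∧ (2304 * (L : ℝ) ^ 6 * (Fintype.card (Fol L) : ℝ))⁻¹ ≤ 1 / 2304 :=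
  ⟨by exact_mod_cast NeZero.one_le, by exact_mod_cast one_le_card_fol (L := L), card_fol_real_le (L := L), (folMu_pos_le (L := L)).1,
    (folMu_pos_le (L := L)).2⟩

/-- ★ The shell radius `r(L) = μ_F/(6|Fol|·122689728·L⁴)`: `0 < r ≤ 1`, `122689728·r·L⁴ ≤ μ_F/2`, the matching exponent is exactly `1/2`,
`8/r ≤ 8·6·122689728·2304·36·L¹⁸` and `r ≥ r₀/L¹⁸`, `r₀ = (2304·6·122689728·36)⁻¹`. [folklore] -/
theorem shellRadius_facts :
    0 < (2304 * (L : ℝ) ^ 6 * (Fintype.card (Fol L) : ℝ))⁻¹ / (6 * (Fintype.card (Fol L) : ℝ) * 122689728 * (L : ℝ) ^ 4) ∧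
    (2304 * (L : ℝ) ^ 6 * (Fintype.card (Fol L) : ℝ))⁻¹ / (6 * (Fintype.card (Fol L) : ℝ) * 122689728 * (L : ℝ) ^ 4) ≤ 1 ∧
    122689728 * ((2304 * (L : ℝ) ^ 6 * (Fintype.card (Fol L) : ℝ))⁻¹ / (6 * (Fintype.card (Fol L) : ℝ) * 122689728 * (L : ℝ) ^ 4)) * (L : ℝ) ^ 4 ≤
      (2304 * (L : ℝ) ^ 6 * (Fintype.card (Fol L) : ℝ))⁻¹ / 2 ∧
    (3 * (Fintype.card (Fol L) : ℝ)) * (122689728 * ((2304 * (L : ℝ) ^ 6 * (Fintype.card (Fol L) : ℝ))⁻¹ /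
        (6 * (Fintype.card (Fol L) : ℝ) * 122689728 * (L : ℝ) ^ 4)) * (L : ℝ) ^ 4) / (2304 * (L : ℝ) ^ 6 * (Fintype.card (Fol L) : ℝ))⁻¹ = 1 / 2 ∧
    8 / ((2304 * (L : ℝ) ^ 6 * (Fintype.card (Fol L) : ℝ))⁻¹ / (6 * (Fintype.card (Fol L) : ℝ) * 122689728 * (L : ℝ) ^ 4)) ≤
      8 * 6 * 122689728 * 2304 * 36 * (L : ℝ) ^ 18 ∧
    (2304 * 6 * 122689728 * 36 : ℝ)⁻¹ / (L : ℝ) ^ 18 ≤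
      (2304 * (L : ℝ) ^ 6 * (Fintype.card (Fol L) : ℝ))⁻¹ / (6 * (Fintype.card (Fol L) : ℝ) * 122689728 * (L : ℝ) ^ 4) := by
  obtain ⟨hL1, hc1, hc6, hμ0, hμle⟩ := cell_sizes (L := L)
  have hL0 : (0 : ℝ) < L := by linarith
  set n : ℝ := (Fintype.card (Fol L) : ℝ) with hn
  have hn0 : 0 < n := by linarith
  have hL4 : (1 : ℝ) ≤ (L : ℝ) ^ 4 := one_le_pow₀ hL1
  have hden : 0 < 6 * n * 122689728 * (L : ℝ) ^ 4 := by positivity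
  refine ⟨by positivity, ?_, ?_, ?_, ?_, ?_⟩
  · rw [div_le_one hden]; nlinarith
  · have e : 122689728 * ((2304 * (L : ℝ) ^ 6 * n)⁻¹ / (6 * n * 122689728 * (L : ℝ) ^ 4)) * (L : ℝ) ^ 4 =
        (2304 * (L : ℝ) ^ 6 * n)⁻¹ / (6 * n) := by field_simp
    rw [e, div_le_div_iff_of_pos_left hμ0 (by positivity) (by norm_num)]
    linarith
  · field_simp; ring
  · have e : 8 / ((2304 * (L : ℝ) ^ 6 * n)⁻¹ / (6 * n * 122689728 * (L : ℝ) ^ 4)) = 8 * 6 * 122689728 * 2304 * ((L : ℝ) ^ 10 * (n * n)) := by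
      field_simp
    rw [e]
    have h1 : n * n ≤ 36 * (L : ℝ) ^ 8 := by nlinarith
    have h2 : (L : ℝ) ^ 10 * (n * n) ≤ 36 * (L : ℝ) ^ 18 := by nlinarith [pow_pos hL0 10]
    nlinarith
  · rw [div_le_div_iff₀ (by positivity) hden]
    have h1 : n * n ≤ 36 * (L : ℝ) ^ 8 := by nlinarith
    have e : (2304 * (L : ℝ) ^ 6 * n)⁻¹ * (L : ℝ) ^ 18 = (L : ℝ) ^ 12 / (2304 * n) := by field_simp
    rw [e, le_div_iff₀ (by positivity)]
    have h3 : (2304 * 6 * 122689728 * 36 : ℝ)⁻¹ * (6 * n * 122689728 * (L : ℝ) ^ 4) * (2304 * n) = (n * n) * (L : ℝ) ^ 4 / 36 := by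
      field_simp
    rw [h3, div_le_iff₀ (by norm_num : (0:ℝ) < 36)]
    nlinarith [pow_pos hL0 4]

/-- The smearing radius `ρ(L) = μ_F/(3|Fol|·44712000·L⁴)`: `0 < ρ`, `2ρ ≤ 1` and `((2ρ)(2ρ))⁻¹ ≤ (3·44712000·2304·36)²·L³⁶`. [folklore] -/
theorem smearRadius_facts :
    0 < (2304 * (L : ℝ) ^ 6 * (Fintype.card (Fol L) : ℝ))⁻¹ / (3 * (Fintype.card (Fol L) : ℝ) * 44712000 * (L : ℝ) ^ 4) ∧
    2 * ((2304 * (L : ℝ) ^ 6 * (Fintype.card (Fol L) : ℝ))⁻¹ / (3 * (Fintype.card (Fol L) : ℝ) * 44712000 * (L : ℝ) ^ 4)) ≤ 1 ∧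
    ((2 * ((2304 * (L : ℝ) ^ 6 * (Fintype.card (Fol L) : ℝ))⁻¹ / (3 * (Fintype.card (Fol L) : ℝ) * 44712000 * (L : ℝ) ^ 4))) *
      (2 * ((2304 * (L : ℝ) ^ 6 * (Fintype.card (Fol L) : ℝ))⁻¹ / (3 * (Fintype.card (Fol L) : ℝ) * 44712000 * (L : ℝ) ^ 4))))⁻¹ ≤
      (3 * 44712000 * 2304 * 36) ^ 2 * (L : ℝ) ^ 36 := by
  obtain ⟨hL1, hc1, hc6, hμ0, hμle⟩ := cell_sizes (L := L)
  have hL0 : (0 : ℝ) < L := by linarith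
  set n : ℝ := (Fintype.card (Fol L) : ℝ) with hn
  have hn0 : 0 < n := by linarith
  have hL4 : (1 : ℝ) ≤ (L : ℝ) ^ 4 := one_le_pow₀ hL1
  have hden : 0 < 3 * n * 44712000 * (L : ℝ) ^ 4 := by positivity
  refine ⟨by positivity, ?_, ?_⟩
  · rw [show 2 * ((2304 * (L : ℝ) ^ 6 * n)⁻¹ / (3 * n * 44712000 * (L : ℝ) ^ 4)) = 2 * (2304 * (L : ℝ) ^ 6 * n)⁻¹ / (3 * n * 44712000 * (L : ℝ) ^ 4) by ring,
      div_le_one hden]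
    nlinarith
  · have e : ((2 * ((2304 * (L : ℝ) ^ 6 * n)⁻¹ / (3 * n * 44712000 * (L : ℝ) ^ 4))) *
        (2 * ((2304 * (L : ℝ) ^ 6 * n)⁻¹ / (3 * n * 44712000 * (L : ℝ) ^ 4))))⁻¹ = (3 * 44712000 * 2304 / 2) ^ 2 * ((L : ℝ) ^ 20 * (n * n) ^ 2) := by
      field_simp
    rw [e]
    have h1 : n * n ≤ 36 * (L : ℝ) ^ 8 := by nlinarith
    have h2 : (n * n) ^ 2 ≤ (36 * (L : ℝ) ^ 8) ^ 2 := pow_le_pow_left₀ (by positivity) h1 2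
    have h3 : (L : ℝ) ^ 20 * (n * n) ^ 2 ≤ 36 ^ 2 * (L : ℝ) ^ 36 := by nlinarith [pow_pos hL0 20]
    have h4 : (3 * 44712000 * 2304 / 2 : ℝ) ^ 2 * ((L : ℝ) ^ 20 * (n * n) ^ 2) ≤ (3 * 44712000 * 2304 / 2 : ℝ) ^ 2 * (36 ^ 2 * (L : ℝ) ^ 36) :=
      mul_le_mul_of_nonneg_left h3 (by positivity)
    refine h4.trans ?_
    have h5 : 0 ≤ (L : ℝ) ^ 36 := by positivity
    nlinarith

/-- ★ The shell-side constant at `r = r(L)`: `C_F·(8/r) ≤ (19·20400)⁴·3·(8·6·122689728·2304·36)·L⁵⁰` (`(1+d) ≤ 19L⁴`, `B^{7/2} ≤ B⁴` for `B ≥ 1`,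
matching exponent `= 1/2`, `e^{1/2}·e^{1/2} ≤ 3`). [folklore] -/
theorem shellConst_le :
    (((1 + (finrank ℝ (GnoFol L) : ℝ)) * (20400 * (L : ℝ) ^ 4)) ^ (7 / 2 : ℝ) * Real.exp (1 / 2 : ℝ) *
        Real.exp ((3 * (Fintype.card (Fol L) : ℝ)) * (122689728 * ((2304 * (L : ℝ) ^ 6 * (Fintype.card (Fol L) : ℝ))⁻¹ /
          (6 * (Fintype.card (Fol L) : ℝ) * 122689728 * (L : ℝ) ^ 4)) * (L : ℝ) ^ 4) / (2304 * (L : ℝ) ^ 6 * (Fintype.card (Fol L) : ℝ))⁻¹)) *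
      (8 / ((2304 * (L : ℝ) ^ 6 * (Fintype.card (Fol L) : ℝ))⁻¹ / (6 * (Fintype.card (Fol L) : ℝ) * 122689728 * (L : ℝ) ^ 4))) ≤
      (19 * 20400) ^ 4 * 3 * (8 * 6 * 122689728 * 2304 * 36) * (L : ℝ) ^ 50 := by
  obtain ⟨hL1, hc1, hc6, hμ0, hμle⟩ := cell_sizes (L := L)
  obtain ⟨hr0, hr1, -, hexp, h8r, -⟩ := shellRadius_facts (L := L)
  have hL0 : (0 : ℝ) < L := by linarith
  have hL4 : (1 : ℝ) ≤ (L : ℝ) ^ 4 := one_le_pow₀ hL1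
  rw [hexp]
  have hd : (finrank ℝ (GnoFol L) : ℝ) = 3 * (Fintype.card (Fol L) : ℝ) := finrank_gnoFol_real (L := L)
  -- the base
  set B : ℝ := (1 + (finrank ℝ (GnoFol L) : ℝ)) * (20400 * (L : ℝ) ^ 4) with hB
  have hB1 : 1 ≤ B := by
    rw [hB, hd]
    have : (1 : ℝ) ≤ 1 + 3 * (Fintype.card (Fol L) : ℝ) := by linarith
    nlinarith
  have hBle : B ≤ 19 * 20400 * (L : ℝ) ^ 8 := by
    rw [hB, hd]
    have h1 : 1 + 3 * (Fintype.card (Fol L) : ℝ) ≤ 19 * (L : ℝ) ^ 4 := by nlinarith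
    nlinarith [pow_pos hL0 4]
  have hB72 : B ^ (7 / 2 : ℝ) ≤ (19 * 20400) ^ 4 * (L : ℝ) ^ 32 := by
    have h1 : B ^ (7 / 2 : ℝ) ≤ B ^ (4 : ℝ) := Real.rpow_le_rpow_of_exponent_le hB1 (by norm_num)
    have h2 : B ^ (4 : ℝ) = B ^ (4 : ℕ) := by rw [show (4 : ℝ) = ((4 : ℕ) : ℝ) by norm_num, Real.rpow_natCast]
    have h3 : B ^ (4 : ℕ) ≤ (19 * 20400 * (L : ℝ) ^ 8) ^ 4 := pow_le_pow_left₀ (by linarith) hBle 4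
    calc B ^ (7 / 2 : ℝ) ≤ B ^ (4 : ℕ) := h1.trans h2.le
      _ ≤ (19 * 20400 * (L : ℝ) ^ 8) ^ 4 := h3
      _ = (19 * 20400) ^ 4 * (L : ℝ) ^ 32 := by ring
  have hee : Real.exp (1 / 2 : ℝ) * Real.exp (1 / 2 : ℝ) ≤ 3 := by
    rw [← Real.exp_add, show (1 / 2 : ℝ) + 1 / 2 = 1 by norm_num]
    have := Real.exp_one_lt_d9; linarith
  have hB0 : 0 ≤ B ^ (7 / 2 : ℝ) := Real.rpow_nonneg (by linarith) _
  calc B ^ (7 / 2 : ℝ) * Real.exp (1 / 2 : ℝ) * Real.exp (1 / 2 : ℝ) *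
        (8 / ((2304 * (L : ℝ) ^ 6 * (Fintype.card (Fol L) : ℝ))⁻¹ / (6 * (Fintype.card (Fol L) : ℝ) * 122689728 * (L : ℝ) ^ 4)))
      = B ^ (7 / 2 : ℝ) * (Real.exp (1 / 2 : ℝ) * Real.exp (1 / 2 : ℝ)) *
        (8 / ((2304 * (L : ℝ) ^ 6 * (Fintype.card (Fol L) : ℝ))⁻¹ / (6 * (Fintype.card (Fol L) : ℝ) * 122689728 * (L : ℝ) ^ 4))) := by ring
    _ ≤ (19 * 20400) ^ 4 * (L : ℝ) ^ 32 * 3 * (8 * 6 * 122689728 * 2304 * 36 * (L : ℝ) ^ 18) :=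
        mul_le_mul (mul_le_mul hB72 hee (by positivity) (by positivity)) h8r (by positivity) (by positivity)
    _ = (19 * 20400) ^ 4 * 3 * (8 * 6 * 122689728 * 2304 * 36) * (L : ℝ) ^ 50 := by ring

/-! ## §3 ★★ The main part carries the rate `τ^{1/6}` -/

set_option maxHeartbeats 800000 in
/-- ★★ **THE MAIN PART OF THE PLUG CARRIES `τ^{1/6}` WITH A POLYNOMIAL CONSTANT**: for `0 < τ ≤ 1`, `0 < b`, any `ε`, `0 ≤ CA`, with the shell radius `r(L)`,
the smearing radius `ρ(L)`, the common rate `c = b/(6·55200L⁶)` and the follower prefactor `a = CA·L^cA·(2π/((1−1/(2d))b))^{d/2}`: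
`2κ_L·(coneConst·π·(K(c)·(a·(e·Kσ + √τ)·(C_F(8/r)·Shell)))) ≤ C·L^{114+cA}·τ^{1/6}·((2π/b)^α·(coneConst·π·Shell))`
(✓`leaderK_common_le`, ✓`SigmaBall.folGauss_prefactor_le`, ✓`SigmaBall.b_pow_combine` with `(7+d)/2 = α`, ✓`slabFactor_le`, ✓`shellConst_le`). [folklore] -/
theorem mainPart_rate {CA : ℝ} (hCA : 0 ≤ CA) (cA : ℕ) {τ : ℝ} (hτ : 0 < τ) (hτ1 : τ ≤ 1) {b : ℝ} (hb : 0 < b) (ε : GnoSign L) :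
    2 * stiffKappa L (1 / 8) * (coneConst * Real.pi *
      ((Real.pi ^ 2 / (b / (6 * (55200 * (L : ℝ) ^ 6))) * (Real.pi ^ 2 / (b / (6 * (55200 * (L : ℝ) ^ 6)))) *
          (2 * (∫ w : EuclideanSpace ℝ (Fin 3), ((1 + ‖w‖ ^ 2) ^ 2)⁻¹) / ((1 + b / (6 * (55200 * (L : ℝ) ^ 6))) * Real.sqrt (1 + b / (6 * (55200 * (L : ℝ) ^ 6)))))) *
        (CA * (L : ℝ) ^ cA * (2 * Real.pi / ((1 - 1 / (2 * (finrank ℝ (GnoFol L) : ℝ))) * b)) ^ ((finrank ℝ (GnoFol L) : ℝ) / 2) *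
          (Real.exp 1 * (900 * (Real.sqrt τ) ^ (1 / 3 : ℝ) *
              (2 * ((2304 * (L : ℝ) ^ 6 * (Fintype.card (Fol L) : ℝ))⁻¹ / (3 * (Fintype.card (Fol L) : ℝ) * 44712000 * (L : ℝ) ^ 4))) ^ (1 / 3 : ℝ) *
              (2 * ((2304 * (L : ℝ) ^ 6 * (Fintype.card (Fol L) : ℝ))⁻¹ / (3 * (Fintype.card (Fol L) : ℝ) * 44712000 * (L : ℝ) ^ 4))) ^ (1 / 3 : ℝ) *
              ((2 * ((2304 * (L : ℝ) ^ 6 * (Fintype.card (Fol L) : ℝ))⁻¹ / (3 * (Fintype.card (Fol L) : ℝ) * 44712000 * (L : ℝ) ^ 4))) *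
                (2 * ((2304 * (L : ℝ) ^ 6 * (Fintype.card (Fol L) : ℝ))⁻¹ / (3 * (Fintype.card (Fol L) : ℝ) * 44712000 * (L : ℝ) ^ 4))))⁻¹) + Real.sqrt τ) *
            ((((1 + (finrank ℝ (GnoFol L) : ℝ)) * (20400 * (L : ℝ) ^ 4)) ^ (7 / 2 : ℝ) * Real.exp (1 / 2 : ℝ) *
                Real.exp ((3 * (Fintype.card (Fol L) : ℝ)) * (122689728 * ((2304 * (L : ℝ) ^ 6 * (Fintype.card (Fol L) : ℝ))⁻¹ /
                  (6 * (Fintype.card (Fol L) : ℝ) * 122689728 * (L : ℝ) ^ 4)) * (L : ℝ) ^ 4) / (2304 * (L : ℝ) ^ 6 * (Fintype.card (Fol L) : ℝ))⁻¹)) *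
              (8 / ((2304 * (L : ℝ) ^ 6 * (Fintype.card (Fol L) : ℝ))⁻¹ / (6 * (Fintype.card (Fol L) : ℝ) * 122689728 * (L : ℝ) ^ 4))) *
              ∫ δ' in Icc ((2304 * (L : ℝ) ^ 6 * (Fintype.card (Fol L) : ℝ))⁻¹ / (6 * (Fintype.card (Fol L) : ℝ) * 122689728 * (L : ℝ) ^ 4) / 2)
                ((2304 * (L : ℝ) ^ 6 * (Fintype.card (Fol L) : ℝ))⁻¹ / (6 * (Fintype.card (Fol L) : ℝ) * 122689728 * (L : ℝ) ^ 4)),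
                ((1 + δ' ^ 2)⁻¹) ^ 2 * ∫ p : ℝ × ℝ, mbDensity (L := L) (hubAt δ' 1) ε p)))) ≤
      (18 * (Real.pi ^ 4 * (2 * ∫ w : EuclideanSpace ℝ (Fin 3), ((1 + ‖w‖ ^ 2) ^ 2)⁻¹) * 331200 ^ 4) * (CA * (4 / 3)) *
          (900 * Real.exp 1 * ((3 * 44712000 * 2304 * 36) ^ 2) + 1) * ((19 * 20400) ^ 4 * 3 * (8 * 6 * 122689728 * 2304 * 36)) *
          (2 * Real.pi) ^ (-(7 / 2 : ℝ))) *
        (L : ℝ) ^ (114 + cA) * τ ^ (1 / 6 : ℝ) *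
        ((2 * Real.pi / b) ^ alpha L * (coneConst * Real.pi *
          ∫ δ' in Icc ((2304 * (L : ℝ) ^ 6 * (Fintype.card (Fol L) : ℝ))⁻¹ / (6 * (Fintype.card (Fol L) : ℝ) * 122689728 * (L : ℝ) ^ 4) / 2)
                ((2304 * (L : ℝ) ^ 6 * (Fintype.card (Fol L) : ℝ))⁻¹ / (6 * (Fintype.card (Fol L) : ℝ) * 122689728 * (L : ℝ) ^ 4)),
            ((1 + δ' ^ 2)⁻¹) ^ 2 * ∫ p : ℝ × ℝ, mbDensity (L := L) (hubAt δ' 1) ε p)) := by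
  obtain ⟨hL1, hc1, hc6, hμ0, hμle⟩ := cell_sizes (L := L)
  have hL0 : (0 : ℝ) < L := by linarith
  obtain ⟨hρ0, h2ρ1, hR⟩ := smearRadius_facts (L := L)
  have hCF := shellConst_le (L := L)
  -- names
  set r : ℝ := (2304 * (L : ℝ) ^ 6 * (Fintype.card (Fol L) : ℝ))⁻¹ / (6 * (Fintype.card (Fol L) : ℝ) * 122689728 * (L : ℝ) ^ 4) with hr
  set ρ : ℝ := (2304 * (L : ℝ) ^ 6 * (Fintype.card (Fol L) : ℝ))⁻¹ / (3 * (Fintype.card (Fol L) : ℝ) * 44712000 * (L : ℝ) ^ 4) with hρ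
  set d : ℝ := (finrank ℝ (GnoFol L) : ℝ) with hd
  set C3 : ℝ := ∫ w : EuclideanSpace ℝ (Fin 3), ((1 + ‖w‖ ^ 2) ^ 2)⁻¹ with hC3def
  set Shell : ℝ := ∫ δ' in Icc (r / 2) r, ((1 + δ' ^ 2)⁻¹) ^ 2 * ∫ p : ℝ × ℝ, mbDensity (L := L) (hubAt δ' 1) ε p with hShell
  set κc : ℝ := 6 * (55200 * (L : ℝ) ^ 6) with hκc
  set β : ℝ := b⁻¹ * b⁻¹ * (b * Real.sqrt b)⁻¹ with hβ
  set G : ℝ := (2 * Real.pi / b) ^ (d / 2) with hG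
  set X1 : ℝ := 2 * stiffKappa L (1 / 8) with hX1
  set X2 : ℝ := Real.pi ^ 2 / (b / κc) * (Real.pi ^ 2 / (b / κc)) * (2 * C3 / ((1 + b / κc) * Real.sqrt (1 + b / κc))) with hX2
  set X3 : ℝ := CA * (L : ℝ) ^ cA * (2 * Real.pi / ((1 - 1 / (2 * d)) * b)) ^ (d / 2) with hX3
  set X4 : ℝ := Real.exp 1 * (900 * (Real.sqrt τ) ^ (1 / 3 : ℝ) * (2 * ρ) ^ (1 / 3 : ℝ) * (2 * ρ) ^ (1 / 3 : ℝ) * ((2 * ρ) * (2 * ρ))⁻¹) + Real.sqrt τ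
    with hX4
  set X5 : ℝ := ((1 + d) * (20400 * (L : ℝ) ^ 4)) ^ (7 / 2 : ℝ) * Real.exp (1 / 2 : ℝ) *
      Real.exp ((3 * (Fintype.card (Fol L) : ℝ)) * (122689728 * r * (L : ℝ) ^ 4) / (2304 * (L : ℝ) ^ 6 * (Fintype.card (Fol L) : ℝ))⁻¹) * (8 / r) with hX5
  -- sizes
  have hC3 : 0 ≤ C3 := integral_nonneg fun w => by positivity
  have hShell0 : 0 ≤ Shell :=
    setIntegral_nonneg measurableSet_Icc fun δ' _ => mul_nonneg (by positivity) (integral_nonneg fun p => mbDensity_nonneg _ ε p)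
  have hcc : 0 < coneConst * Real.pi := mul_pos coneConst_pos Real.pi_pos
  have hκc1 : 1 ≤ κc := by rw [hκc]; nlinarith [one_le_pow₀ (n := 6) hL1]
  have hd2 : 2 ≤ d := by rw [hd]; linarith [nine_le_finrank_gnoFol (L := L)]
  have hβ0 : 0 ≤ β := by rw [hβ]; positivity
  have hG0 : 0 ≤ G := by rw [hG]; positivity
  have hτ6 : 0 ≤ τ ^ (1 / 6 : ℝ) := Real.rpow_nonneg hτ.le _
  -- the five bounds
  have h1 : X1 ≤ 18 * (L : ℝ) ^ 4 := by rw [hX1]; unfold stiffKappa; nlinarith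
  have h1' : 0 ≤ X1 := by rw [hX1]; unfold stiffKappa; nlinarith [one_le_pow₀ (n := 4) hL1]
  have h2 : X2 ≤ (Real.pi ^ 4 * (2 * C3) * κc ^ 4) * β := by rw [hX2, hβ]; exact leaderK_common_le hb hκc1 hC3
  have h2' : 0 ≤ X2 := by rw [hX2]; positivity
  have h3 : X3 ≤ CA * (L : ℝ) ^ cA * ((4 / 3) * G) := by
    rw [hX3, hG]; exact mul_le_mul_of_nonneg_left (SigmaBall.folGauss_prefactor_le hd2 hb) (by positivity)
  have h3' : 0 ≤ X3 := by
    rw [hX3]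
    have hq : 0 < 1 - 1 / (2 * d) := by
      have : 1 / (2 * d) ≤ 1 / 4 := by rw [div_le_div_iff₀ (by positivity) (by norm_num)]; linarith
      linarith
    exact mul_nonneg (by positivity) (Real.rpow_nonneg (by positivity) _)
  have h4 : X4 ≤ (900 * Real.exp 1 * ((3 * 44712000 * 2304 * 36) ^ 2) + 1) * (L : ℝ) ^ 36 * τ ^ (1 / 6 : ℝ) := by
    have h := slabFactor_le hτ hτ1 hρ0 h2ρ1
    rw [hX4]
    refine h.trans ?_
    have hL36 : (1 : ℝ) ≤ (L : ℝ) ^ 36 := one_le_pow₀ hL1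
    have hin : 900 * Real.exp 1 * ((2 * ρ) * (2 * ρ))⁻¹ + 1 ≤ (900 * Real.exp 1 * ((3 * 44712000 * 2304 * 36) ^ 2) + 1) * (L : ℝ) ^ 36 := by
      have e0 := (Real.exp_pos 1).le
      nlinarith [mul_le_mul_of_nonneg_left hR (by positivity : (0:ℝ) ≤ 900 * Real.exp 1)]
    exact mul_le_mul_of_nonneg_right hin hτ6
  have h4' : 0 ≤ X4 := by
    rw [hX4]
    have h2ρ : 0 ≤ 2 * ρ := by linarith
    exact add_nonneg (mul_nonneg (Real.exp_pos 1).le (mul_nonneg (mul_nonneg (mul_nonneg (mul_nonneg (by norm_num)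
      (Real.rpow_nonneg (Real.sqrt_nonneg _) _)) (Real.rpow_nonneg h2ρ _)) (Real.rpow_nonneg h2ρ _)) (inv_nonneg.2 (mul_nonneg h2ρ h2ρ))))
      (Real.sqrt_nonneg _)
  have h5 : X5 ≤ (19 * 20400) ^ 4 * 3 * (8 * 6 * 122689728 * 2304 * 36) * (L : ℝ) ^ 50 := by rw [hX5, hd, hr]; exact hCF
  have h5' : 0 ≤ X5 := by
    rw [hX5]
    have hr0 : 0 < r := (shellRadius_facts (L := L)).1
    exact mul_nonneg (mul_nonneg (mul_nonneg (Real.rpow_nonneg (by positivity) _) (Real.exp_pos _).le) (Real.exp_pos _).le) (by positivity)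
  -- the product
  have hprod : X1 * X2 * X3 * X4 * X5 ≤ (18 * (L : ℝ) ^ 4) * ((Real.pi ^ 4 * (2 * C3) * κc ^ 4) * β) * (CA * (L : ℝ) ^ cA * ((4 / 3) * G)) *
      ((900 * Real.exp 1 * ((3 * 44712000 * 2304 * 36) ^ 2) + 1) * (L : ℝ) ^ 36 * τ ^ (1 / 6 : ℝ)) *
      ((19 * 20400) ^ 4 * 3 * (8 * 6 * 122689728 * 2304 * 36) * (L : ℝ) ^ 50) := by
    have hY1 : 0 ≤ 18 * (L : ℝ) ^ 4 := by positivity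
    refine mul_le_mul (mul_le_mul (mul_le_mul (mul_le_mul h1 h2 h2' hY1) h3 h3' (mul_nonneg hY1 (h2'.trans h2))) h4 h4'
      (mul_nonneg (mul_nonneg hY1 (h2'.trans h2)) (h3'.trans h3))) h5 h5' ?_
    exact mul_nonneg (mul_nonneg (mul_nonneg hY1 (h2'.trans h2)) (h3'.trans h3)) (h4'.trans h4)
  -- the b-powers
  have hβG : β * G = (2 * Real.pi) ^ (-(7 / 2 : ℝ)) * (2 * Real.pi / b) ^ alpha L := by
    rw [hβ, hG, SigmaBall.b_pow_combine hb]
    congr 1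
    unfold alpha
    rw [finrank_gnoFibre_eq_card, hd, finrank_gnoFol_real]
  have hκc4 : κc ^ 4 = 331200 ^ 4 * (L : ℝ) ^ 24 := by rw [hκc]; ring
  -- assemble
  have eL : 2 * stiffKappa L (1 / 8) * (coneConst * Real.pi * (X2 * (X3 * X4 * (X5 * Shell)))) = (coneConst * Real.pi * Shell) * (X1 * X2 * X3 * X4 * X5) := by
    rw [hX1]; ring
  rw [eL]
  have hfin := mul_le_mul_of_nonneg_left hprod (mul_nonneg hcc.le hShell0)
  refine hfin.trans (le_of_eq ?_)
  rw [hκc4, pow_add]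
  have e2 : (coneConst * Real.pi * Shell) * ((18 * (L : ℝ) ^ 4) * ((Real.pi ^ 4 * (2 * C3) * (331200 ^ 4 * (L : ℝ) ^ 24)) * β) *
      (CA * (L : ℝ) ^ cA * ((4 / 3) * G)) * ((900 * Real.exp 1 * ((3 * 44712000 * 2304 * 36) ^ 2) + 1) * (L : ℝ) ^ 36 * τ ^ (1 / 6 : ℝ)) *
      ((19 * 20400) ^ 4 * 3 * (8 * 6 * 122689728 * 2304 * 36) * (L : ℝ) ^ 50)) =
      (18 * (Real.pi ^ 4 * (2 * C3) * 331200 ^ 4) * (CA * (4 / 3)) * (900 * Real.exp 1 * ((3 * 44712000 * 2304 * 36) ^ 2) + 1) *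
        ((19 * 20400) ^ 4 * 3 * (8 * 6 * 122689728 * 2304 * 36))) * ((L : ℝ) ^ 114 * (L : ℝ) ^ cA) * τ ^ (1 / 6 : ℝ) * ((β * G) * (coneConst * Real.pi * Shell)) := by
    ring
  rw [e2, hβG]
  ring

end Summit.QuantumFields.YangMills.Theorems.SwapVirialDeficit.SectorLaplace

end
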